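import Literature.Analysis.FluidPDE.ClassicalSolutionGlue
import Literature.Analysis.FluidPDE.CriticalRegularity
import Literature.Analysis.FluidPDE.LerayHopfRestart
import Literature.Analysis.FluidPDE.NSLerayHopf
import Literature.Analysis.FluidPDE.SobolevWeakGradient
import HarnessLib

/-!
# Cheskidov–Shvydkoy: "regular" solutions, Lemma 3.2 and Leray's continuation theorem

Analysis/FluidPDE file (serves the discharge of `Literature.Analysis.FluidPDE.cheskidov_shvydkoy`, ns.S31, the
regularity criterion of Cheskidov–Shvydkoy, Arch. Ration. Mech. Anal. 195 (2010), Thm. 3.1, in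
the largest critical space `B^{-1}_{∞,∞}`; continuation of
`Literature.Analysis.FluidPDE.CheskidovShvydkoy`).

Cheskidov–Shvydkoy prove Thm. 3.1 from two ingredients (p. 6 of arXiv:0708.3067): their
Lemma 3.2 (the dyadic criterion `limsup_q sup_t λ_q⁻¹ ‖u_q(t)‖_∞ < cν ⟹ u regular on (0,T]`,
obtained from frequency-localised energy estimates) and "Theorem 2.4 (Leray)" (a Leray–Hopf
solution whose `H^s` norm, `s > 1/2`, stays bounded at the right end of every interval of
regularity is regular on `(0, T]`). Both are statements about **regular** solutions in the
sense of the paper (p. 4: "A weak solution `u(t)` of (NSE) on a time interval `I` is called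
regular if `‖u(t)‖_{H¹}` is continuous on `I`"), whereas the accepted `NS.cheskidov_shvydkoy` and
the facts of `CheskidovShvydkoy.lean` render "regular on `(0, T]`" in the house form of ns.S07
(a classical representative on the time set `Ioc 0 T`). This file

* defines the paper's notion: the squared `H¹` norm `Fluid.eH1NormSq v = ‖v‖²_{L²} + ‖∇v‖²_{L²}`
  of a vector field (`∞` unless `v ∈ L²` with an `L²` weak gradient; built on the accepted
  `Fluid.eEnergy` and `Fluid.eWeakGradL2Sq`) and `Fluid.IsH1RegularOn I u`
  ("`‖u(t)‖_{H¹}` is finite and continuous on `I`");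
* vendors, as named facts in this literal form, **Lemma 3.2**
  (`NS.cheskidov_shvydkoy_dyadic_regular`) and **Thm. 2.4 in the case `s = 1`**
  (`NS.leray_continuation_H1`: the instance used in the proof of Thm. 3.1, where Lemma 3.2
  supplies continuity of the `H¹` norm up to `β`);
* **proves** the passage from `H¹`-regularity to the house rendering
  (`NS.classical_of_isH1RegularOn`: a Leray–Hopf solution which is `H¹`-regular on `(0, T]`
  has a classical representative on `Ioc 0 T`) from the accepted Ladyzhenskaya–Prodi–Serrin
  fact `NS.ladyzhenskaya_prodi_serrin` (ns.S07) — `H¹ ⊂ L⁶` puts the restarted solution in the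
  Serrin class `L^∞_t L⁶_x` (Robinson–Rodrigo–Sadowski 2016, Thm. 8.17 and the remark before it:
  restart at good times `t_n → 0`), the restarts being supplied by
  `Fluid.IsLerayHopfOn.exists_isLerayHopfOn_restart` (`LerayHopfRestart`) and the classical
  representatives on the nested time sets `(s_n, T]` being glued by
  `Fluid.IsClassicalNSSolutionOn.exists_glue_Ioc`;
* the assembly "Lemma 3.2 + Thm. 2.4 (`s = 1`) + ns.S07 ⟹ Thm. 3.1 as printed
  (`NS.cheskidov_shvydkoy_inhom`) ⟹ the accepted `NS.cheskidov_shvydkoy`", which follows the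
  printed proof (p. 6) and uses the facts of `CheskidovShvydkoy.lean`, is the sibling proofs
  file `CheskidovShvydkoyReduction.lean`.

What then remains for `cheskidov_shvydkoy_holds`: the two named facts of this file (Lemma 3.2: the
paraproduct energy estimates of Cheskidov–Shvydkoy 2010, pp. 5–6; Thm. 2.4: Leray's structure
theory — local strong `H¹` solutions with lifespan `≳ ν³/‖∇u₀‖⁴`, weak–strong uniqueness
(proved in the tree, `NS.serrin_weak_strong_uniqueness_holds`) and restarting
(`LerayHopfRestart`)) and the accepted ns.S07.

## Conventions

* `‖v‖²_{H¹} = ‖v‖²_{L²} + ‖∇v‖²_{L²}` (Robinson–Rodrigo–Sadowski 2016, (1.12): `‖u‖_{W^{1,p}} =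
  (∫|u|^p + Σᵢ ∫|∂ᵢu|^p)^{1/p}`, `H¹ = W^{1,2}`, the sum over `i` being the Frobenius density;
  Cheskidov–Shvydkoy do not fix a normalisation — for Leray–Hopf solutions, which are weakly
  continuous in `L²`, continuity of any of the equivalent Hilbert norms of `H¹` along the
  trajectory is equivalent to strong continuity into `H¹`, so the notion of regularity does not
  depend on the choice). The gradient is the weak gradient of the accepted
  `Fluid.HasWeakGradient`, its `L²` mass the accepted `Fluid.eWeakGradL2Sq` (an infimum over
  weak gradients, attained by each of them: `Fluid.eWeakGradL2Sq_eq_of_hasWeakGradient`).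
* "Interval of regularity" in Thm. 2.4 is rendered as *any* open interval `(α, β) ⊆ (0, T)` on
  which `u` is `H¹`-regular (not only the maximal ones); the hypothesis of the vendored statement
  is thereby at least as strong as the printed one, so the vendored fact is implied by the
  printed theorem.

## Mathlib search

Mathlib (this pin) has no Navier–Stokes theory and no weak-gradient `H¹` norm; the tree has the
weak-gradient calculus (`VectorCalculus`, `SobolevWeakGradient`: `H¹ ⊂ L⁶`), the Leray–Hopf
class, ns.S07 as a named fact, and the gluing/translation bookkeeping of classical solutions
(`ClassicalSolutionGlue`).

## References

* A. Cheskidov, R. Shvydkoy, *The regularity of weak solutions of the 3D Navier–Stokes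
  equations in `B^{-1}_{∞,∞}`*, Arch. Ration. Mech. Anal. 195 (2010) 159–169 = arXiv:0708.3067:
  p. 4 (Def. 2.1, Def. 2.3, "regular", Thm. 2.4), p. 5 (Thm. 3.1, Lemma 3.2), p. 6 (Cor. 3.3,
  proof of Thm. 3.1).
* J. C. Robinson, J. L. Rodrigo, W. Sadowski, *The Three-Dimensional Navier–Stokes Equations.
  Classical theory*, CUP 2016: Def. 8.2, Lemma 8.4, Thm. 8.14 (epochs of regularity), Thm. 8.17
  and the remark before it (Serrin condition, restart at good times), Thm. 6.8, Cor. 4.8.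
* J. Leray, Acta Math. 63 (1934), §III–IV (structure theorem, "époques d'irrégularité").
-/

noncomputable section

open MeasureTheory TopologicalSpace Set Function Filter Topology InnerProductSpace Metric Module
open scoped RealInnerProductSpace ENNReal NNReal Laplacian SchwartzMap

/-! ## The `H¹` norm through weak gradients; `H¹`-regular trajectories -/

namespace Literature.Analysis.FluidPDE

section H1

variable {E : Type*} [NormedAddCommGroup E] [InnerProductSpace ℝ E] [FiniteDimensional ℝ E]
  [MeasurableSpace E] [BorelSpace E]
variable {F' : Type*} [NormedAddCommGroup F'] [InnerProductSpace ℝ F']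

/-- The **squared `H¹` norm** `‖v‖²_{H¹} = ‖v‖²_{L²} + ‖∇v‖²_{L²} ∈ [0, ∞]` of a vector field on
the whole space, through the accepted extended energy `Fluid.eEnergy v = ∫⁻ ‖v‖ₑ²` and the
accepted weak dissipation `Fluid.eWeakGradL2Sq v = ∫⁻ |∇v|²` (an infimum over the weak gradients
of `v`, `= ∞` if there is none): finite iff `v ∈ L²` has a square-integrable weak gradient,
i.e. `v ∈ H¹` (Robinson–Rodrigo–Sadowski 2016, (1.12) with `p = 2`: `‖u‖²_{H¹} = ∫|u|² + Σᵢ ∫|∂ᵢu|²`, the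
sum being the Frobenius density `Fluid.frobeniusNormSq` of the weak gradient; Evans, *PDE*,
§5.2.2). [folklore] -/
def eH1NormSq (v : E → F') : ℝ≥0∞ :=
  eEnergy v + eWeakGradL2Sq v

/-- Unfolding `eH1NormSq`. [folklore] -/
theorem eH1NormSq_def (v : E → F') : eH1NormSq v = eEnergy v + eWeakGradL2Sq v :=
  rfl

/-- Any weak gradient bounds the weak dissipation: `∫⁻ |∇v|² ≤ ∫⁻ |G|²` for
`HasWeakGradient v G` (the infimum is over all weak gradients). [folklore] -/
theorem eWeakGradL2Sq_le_of_hasWeakGradient {v : E → F'} {G : E → E →L[ℝ] F'}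
    (h : HasWeakGradient v G) :
    eWeakGradL2Sq v ≤ ∫⁻ x, ENNReal.ofReal (frobeniusNormSq (G x)) :=
  iInf₂_le G h

/-- **The weak dissipation is attained by every weak gradient**: weak gradients are a.e. unique
(accepted `HasWeakFDerivOn.unique_holds`), so `∫⁻ |∇v|² = ∫⁻ |G|²` for any
`HasWeakGradient v G` (Evans, *PDE*, §5.2.1). [folklore] -/
theorem eWeakGradL2Sq_eq_of_hasWeakGradient [CompleteSpace F'] {v : E → F'}
    {G : E → E →L[ℝ] F'} (h : HasWeakGradient v G) :
    eWeakGradL2Sq v = ∫⁻ x, ENNReal.ofReal (frobeniusNormSq (G x)) := by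
  refine le_antisymm (eWeakGradL2Sq_le_of_hasWeakGradient h) (le_iInf₂ fun G' h' => ?_)
  have hae : G' =ᵐ[volume] G := by
    have := FunctionSpaces.HasWeakFDerivOn.unique_holds h' h
    simpa [Measure.restrict_univ] using this
  refine (lintegral_congr_ae ?_).le
  filter_upwards [hae] with x hx
  rw [hx]

/-- The squared `H¹` norm is bounded through any weak gradient:
`‖v‖²_{H¹} ≤ ∫⁻ ‖v‖ₑ² + ∫⁻ |G|²`. [folklore] -/
theorem eH1NormSq_le_of_hasWeakGradient {v : E → F'} {G : E → E →L[ℝ] F'}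
    (h : HasWeakGradient v G) :
    eH1NormSq v ≤ eEnergy v + ∫⁻ x, ENNReal.ofReal (frobeniusNormSq (G x)) :=
  add_le_add le_rfl (eWeakGradL2Sq_le_of_hasWeakGradient h)

/-- **A strict bound on the `H¹` norm is witnessed by a weak gradient**: if `‖v‖²_{H¹} < M` then
`v` has a weak gradient `G` with `∫⁻ ‖v‖ₑ² + ∫⁻ |G|² < M` (the infimum defining
`eWeakGradL2Sq` is over a family which is then non-empty). [folklore] -/
theorem exists_hasWeakGradient_of_eH1NormSq_lt {v : E → F'} {M : ℝ≥0∞} (h : eH1NormSq v < M) :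
    ∃ G : E → E →L[ℝ] F', HasWeakGradient v G ∧
      eEnergy v + ∫⁻ x, ENNReal.ofReal (frobeniusNormSq (G x)) < M := by
  rw [eH1NormSq_def, eWeakGradL2Sq, ENNReal.add_iInf, iInf_lt_iff] at h
  obtain ⟨G, hG⟩ := h
  rw [ENNReal.add_iInf, iInf_lt_iff] at hG
  obtain ⟨hG, hlt⟩ := hG
  exact ⟨G, hG, hlt⟩

/-- **`H¹`-regular trajectories** (Cheskidov–Shvydkoy 2010, p. 4: "A weak solution `u(t)` of
(NSE) on a time interval `I` is called regular if `‖u(t)‖_{H¹}` is continuous on `I`";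
Robinson–Rodrigo–Sadowski 2016, Def. 8.2 for the companion notion of regular *time*):
`t ↦ ‖u(t)‖²_{H¹}` (`eH1NormSq (u t)`) is finite at every `t ∈ I` and continuous on `I` (as an
`ℝ≥0∞`-valued map; for finite values this is continuity of the real norm). [cite: CheskidovShvydkoy2010, p. 4 (definition of a regular solution)] -/
def IsH1RegularOn (I : Set ℝ) (u : ℝ → E → F') : Prop :=
  (∀ t ∈ I, eH1NormSq (u t) < ∞) ∧ ContinuousOn (fun t => eH1NormSq (u t)) I

variable {I J : Set ℝ} {u : ℝ → E → F'}

/-- `H¹`-regularity restricts to smaller time sets. [folklore] -/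
theorem IsH1RegularOn.mono (h : IsH1RegularOn I u) (hJ : J ⊆ I) : IsH1RegularOn J u :=
  ⟨fun t ht => h.1 t (hJ ht), h.2.mono hJ⟩

/-- On an `H¹`-regular time set the `H¹` norm is finite. [folklore] -/
theorem IsH1RegularOn.eH1NormSq_lt_top (h : IsH1RegularOn I u) {t : ℝ} (ht : t ∈ I) :
    eH1NormSq (u t) < ∞ :=
  h.1 t ht

/-- On an `H¹`-regular time set the `H¹` norm is continuous. [folklore] -/
theorem IsH1RegularOn.continuousOn (h : IsH1RegularOn I u) :
    ContinuousOn (fun t => eH1NormSq (u t)) I :=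
  h.2

/-- **`H¹`-regular trajectories are `H¹`-bounded on compact time sets**: on a compact `K ⊆ I`
there is `M < ∞` with `‖u(t)‖²_{H¹} ≤ M` for `t ∈ K` (a continuous function attains its maximum
on a compact set; Robinson–Rodrigo–Sadowski 2016, Def. 8.2: regular times have `‖∇u‖`
essentially bounded nearby). [folklore] -/
theorem IsH1RegularOn.exists_forall_le (h : IsH1RegularOn I u) {K : Set ℝ} (hK : IsCompact K)
    (hKI : K ⊆ I) : ∃ M : ℝ≥0∞, M < ∞ ∧ ∀ t ∈ K, eH1NormSq (u t) ≤ M := by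
  rcases K.eq_empty_or_nonempty with rfl | hne
  · exact ⟨0, ENNReal.zero_lt_top, fun t ht => absurd ht (notMem_empty t)⟩
  · obtain ⟨t₀, ht₀, hmax⟩ := hK.exists_isMaxOn hne (h.2.mono hKI)
    exact ⟨eH1NormSq (u t₀), h.1 t₀ (hKI ht₀), fun t ht => hmax ht⟩

end H1

/-! ## Gluing classical solutions on nested time sets `(s_n, T]` -/

section GlueIoc

variable {E : Type*} [NormedAddCommGroup E] [InnerProductSpace ℝ E] [FiniteDimensional ℝ E]
variable {ν : ℝ}

/-- **Normalised pressures are determined by the velocity, one-sided version.** If two classical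
solutions (same `ν`, same force) on time sets `S₁ ∋ t`, `S₂ ∋ t` have the same velocity slice
and the same one-sided time derivative at time `t`, then `p₁(t,x) - p₁(t,0) = p₂(t,x) - p₂(t,0)`:
the momentum equations give `∇p₁(t,·) = ∇p₂(t,·)`, and a `C¹` function with vanishing
derivative is constant (Mathlib `is_const_of_fderiv_eq_zero`). Companion of the accepted
`IsClassicalNSSolutionOn.pressure_sub_apply_zero_eq_of_eventuallyEq` (interior times). [folklore] -/
theorem IsClassicalNSSolutionOn.pressure_sub_apply_zero_eq_of_timeDerivWithin_eq {S₁ S₂ : Set ℝ}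
    {f u₁ u₂ : ℝ → E → E} {p₁ p₂ : ℝ → E → ℝ} (h₁ : IsClassicalNSSolutionOn S₁ ν f u₁ p₁)
    (h₂ : IsClassicalNSSolutionOn S₂ ν f u₂ p₂) {t : ℝ} (ht₁ : t ∈ S₁) (ht₂ : t ∈ S₂)
    (hu : u₁ t = u₂ t) (hdt : ∀ x, timeDerivWithin S₁ u₁ t x = timeDerivWithin S₂ u₂ t x)
    (x : E) : p₁ t x - p₁ t 0 = p₂ t x - p₂ t 0 := by
  have hgrad : ∀ y, gradient (p₁ t) y = gradient (p₂ t) y := by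
    intro y
    have hm₁ := h₁.momentum t ht₁ y
    have hm₂ := h₂.momentum t ht₂ y
    rw [hdt y, hu] at hm₁
    have h12 := hm₁.symm.trans hm₂
    simpa using h12
  have hd₁ : Differentiable ℝ (p₁ t) := (h₁.contDiff_pressure ht₁).differentiable (by simp)
  have hd₂ : Differentiable ℝ (p₂ t) := (h₂.contDiff_pressure ht₂).differentiable (by simp)
  have hdiff : Differentiable ℝ (fun y => p₁ t y - p₂ t y) := hd₁.sub hd₂
  have hzero : ∀ y, fderiv ℝ (fun y => p₁ t y - p₂ t y) y = 0 := by
    intro y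
    rw [fderiv_fun_sub (hd₁ y) (hd₂ y)]
    have hg := hgrad y
    unfold gradient at hg
    rw [(InnerProductSpace.toDual ℝ E).symm.injective hg, sub_self]
  have hc := is_const_of_fderiv_eq_zero hdiff hzero x 0
  linarith

/-- One-sided time derivatives within nested final segments agree: for `s ≤ s' < t` and
fields agreeing on `(s', T]`, `∂ₜ` within `(s, T]` of the first equals `∂ₜ` within `(s', T]`
of the second at `t` (`(s, T] ∩ (s', ∞) = (s', T]` and `(s', ∞)` is a neighbourhood of `t`;
Mathlib `derivWithin_inter`, `derivWithin_congr`). [folklore] -/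
theorem timeDerivWithin_Ioc_eq_of_eqOn {X F : Type*} [NormedAddCommGroup F] [NormedSpace ℝ F]
    {T s s' t : ℝ} {w₁ w₂ : ℝ → X → F} (hss' : s ≤ s') (hs't : s' < t)
    (heq : ∀ τ ∈ Ioc s' T, w₁ τ = w₂ τ) (htT : t ≤ T) (x : X) :
    timeDerivWithin (Ioc s T) w₁ t x = timeDerivWithin (Ioc s' T) w₂ t x := by
  simp only [timeDerivWithin_apply]
  have hset : Ioc s T ∩ Ioi s' = Ioc s' T := by
    ext τ
    simp only [mem_inter_iff, mem_Ioc, mem_Ioi]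
    constructor
    · rintro ⟨⟨-, h2⟩, h3⟩; exact ⟨h3, h2⟩
    · rintro ⟨h1, h2⟩; exact ⟨⟨hss'.trans_lt h1, h2⟩, h1⟩
  rw [← derivWithin_inter (Ioi_mem_nhds hs't), hset]
  exact derivWithin_congr (fun τ hτ => congrFun (heq τ hτ) x) (congrFun (heq t ⟨hs't, htT⟩) x)

/-- **Gluing classical solutions on nested final segments.** Let `(V n, P n)` be classical
solutions (same `ν`, same force) on the time sets `(s n, T]`, `0 < s n`, with `s n` becoming
arbitrarily small, whose velocities agree on the common part `(max (s m) (s n), T]` of any two of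
the time sets. Then there is a classical solution `(v, p)` on `(0, T]` with `v = V n` on
`(s n, T]` for every `n`: take `v(t) = V n(t)` and the normalised pressure
`p(t) = P n(t) - P n(t, 0)` for any `n` with `s n < t` (independent of `n`: velocities by
hypothesis, normalised pressures by `pressure_sub_apply_zero_eq_of_timeDerivWithin_eq`);
smoothness is local (`(s n, ∞) × E` is open) and the one-sided time derivative within `(0, T]`
at `t > s n` is that within `(s n, T]` (`timeDerivWithin_Ioc_eq_of_eqOn`). [folklore] -/
theorem IsClassicalNSSolutionOn.exists_glue_Ioc {T : ℝ} {f : ℝ → E → E} {s : ℕ → ℝ}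
    {V : ℕ → ℝ → E → E} {P : ℕ → ℝ → E → ℝ} (hs0 : ∀ n, 0 < s n)
    (hs : ∀ t, 0 < t → ∃ n, s n < t)
    (hV : ∀ n, IsClassicalNSSolutionOn (Ioc (s n) T) ν f (V n) (P n))
    (hagree : ∀ m n, ∀ t ∈ Ioc (max (s m) (s n)) T, V m t = V n t) :
    ∃ (v : ℝ → E → E) (p : ℝ → E → ℝ), IsClassicalNSSolutionOn (Ioc 0 T) ν f v p ∧
      ∀ n, ∀ t ∈ Ioc (s n) T, v t = V n t := by
  classical
  -- the index of a piece containing `t`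
  set N : ℝ → ℕ := fun t => if h : ∃ n, s n < t then Nat.find h else 0 with hN_def
  have hN : ∀ t, 0 < t → s (N t) < t := by
    intro t ht
    have h := hs t ht
    simp only [hN_def, dif_pos h]
    exact Nat.find_spec h
  set v : ℝ → E → E := fun t => V (N t) t with hv_def
  set p : ℝ → E → ℝ := fun t x => P (N t) t x - P (N t) t 0 with hp_def
  -- on the piece `(s n, T]` the glued fields are those of the piece `n`
  have hvn : ∀ n, ∀ t ∈ Ioc (s n) T, v t = V n t := by
    intro n t ht
    have ht0 : 0 < t := (hs0 n).trans ht.1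
    exact hagree (N t) n t ⟨max_lt (hN t ht0) ht.1, ht.2⟩
  have hdtn : ∀ m n, ∀ t ∈ Ioc (max (s m) (s n)) T, ∀ x,
      timeDerivWithin (Ioc (s m) T) (V m) t x = timeDerivWithin (Ioc (s n) T) (V n) t x := by
    intro m n t ht x
    have h1 : timeDerivWithin (Ioc (s m) T) (V m) t x =
        timeDerivWithin (Ioc (max (s m) (s n)) T) (V n) t x :=
      timeDerivWithin_Ioc_eq_of_eqOn (le_max_left _ _) ht.1 (fun τ hτ => hagree m n τ hτ) ht.2 x
    have h2 : timeDerivWithin (Ioc (s n) T) (V n) t x =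
        timeDerivWithin (Ioc (max (s m) (s n)) T) (V n) t x :=
      timeDerivWithin_Ioc_eq_of_eqOn (le_max_right _ _) ht.1 (fun τ _ => rfl) ht.2 x
    rw [h1, h2]
  have hpn : ∀ n, ∀ t ∈ Ioc (s n) T, ∀ x, p t x = P n t x - P n t 0 := by
    intro n t ht x
    have ht0 : 0 < t := (hs0 n).trans ht.1
    have hm : t ∈ Ioc (s (N t)) T := ⟨hN t ht0, ht.2⟩
    exact (hV (N t)).pressure_sub_apply_zero_eq_of_timeDerivWithin_eq (hV n) hm ht
      (hagree (N t) n t ⟨max_lt (hN t ht0) ht.1, ht.2⟩) (hdtn (N t) n t ⟨max_lt (hN t ht0) ht.1, ht.2⟩) x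
  -- the time derivative within `(0, T]` is that within the piece
  have hdt0 : ∀ n, ∀ t ∈ Ioc (s n) T, ∀ x,
      timeDerivWithin (Ioc 0 T) v t x = timeDerivWithin (Ioc (s n) T) (V n) t x := fun n t ht x =>
    timeDerivWithin_Ioc_eq_of_eqOn (hs0 n).le ht.1 (hvn n) ht.2 x
  -- relative openness of the pieces
  have hpiece : ∀ n, Ioc 0 T ×ˢ (univ : Set E) ∩ Ioi (s n) ×ˢ univ = Ioc (s n) T ×ˢ univ := by
    intro n
    ext ⟨t, x⟩
    simp only [mem_inter_iff, mem_prod, mem_Ioc, mem_univ, and_true, mem_Ioi]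
    constructor
    · rintro ⟨⟨-, h2⟩, h3⟩; exact ⟨h3, h2⟩
    · rintro ⟨h1, h2⟩; exact ⟨⟨(hs0 n).trans h1, h2⟩, h1⟩
  have hsmooth : ∀ (w : ℝ → E → ℝ) (W : ℕ → ℝ → E → ℝ),
      (∀ n, IsSmoothSpaceTimeOn (Ioc (s n) T) (W n)) →
      (∀ n, ∀ t ∈ Ioc (s n) T, ∀ x, w t x = W n t x) → IsSmoothSpaceTimeOn (Ioc 0 T) w := by
    intro w W hW hwW
    refine contDiffOn_of_locally_contDiffOn fun z hz => ?_
    obtain ⟨n, hn⟩ := hs z.1 hz.1.1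
    refine ⟨Ioi (s n) ×ˢ univ, isOpen_Ioi.prod isOpen_univ, ⟨hn, mem_univ _⟩, ?_⟩
    rw [hpiece n]
    exact (hW n).congr fun z' hz' => hwW n z'.1 hz'.1 z'.2
  have hsmoothE : ∀ (w : ℝ → E → E) (W : ℕ → ℝ → E → E),
      (∀ n, IsSmoothSpaceTimeOn (Ioc (s n) T) (W n)) →
      (∀ n, ∀ t ∈ Ioc (s n) T, w t = W n t) → IsSmoothSpaceTimeOn (Ioc 0 T) w := by
    intro w W hW hwW
    refine contDiffOn_of_locally_contDiffOn fun z hz => ?_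
    obtain ⟨n, hn⟩ := hs z.1 hz.1.1
    refine ⟨Ioi (s n) ×ˢ univ, isOpen_Ioi.prod isOpen_univ, ⟨hn, mem_univ _⟩, ?_⟩
    rw [hpiece n]
    exact (hW n).congr fun z' hz' => by
      show w z'.1 z'.2 = W n z'.1 z'.2
      rw [hwW n z'.1 hz'.1]
  refine ⟨v, p, ⟨?_, ?_, ?_, ?_⟩, hvn⟩
  · exact hsmoothE v V (fun n => (hV n).smooth_velocity) hvn
  · exact hsmooth p (fun n t x => P n t x - P n t 0) (fun n => (hV n).smooth_pressure.sub_apply_zero)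
      hpn
  · intro t ht x
    obtain ⟨n, hn⟩ := hs t ht.1
    have htn : t ∈ Ioc (s n) T := ⟨hn, ht.2⟩
    have hgrad : gradient (p t) x = gradient (P n t) x := by
      rw [show p t = fun y => P n t y - P n t 0 from funext (hpn n t htn), gradient_sub_const]
    rw [hdt0 n t htn x, hvn n t htn, hgrad]
    exact (hV n).momentum t htn x
  · intro t ht
    obtain ⟨n, hn⟩ := hs t ht.1
    rw [hvn n t ⟨hn, ht.2⟩]
    exact (hV n).divFree t ⟨hn, ht.2⟩

end GlueIoc

/-! ## Restarting a Leray–Hopf solution at a good time of a prescribed interval -/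

section Restart

variable {E : Type*} [NormedAddCommGroup E] [InnerProductSpace ℝ E] [FiniteDimensional ℝ E]
  [MeasurableSpace E] [BorelSpace E]
variable {T ν : ℝ} {u : ℝ → E → E} {u₀ : E → E}

omit [NormedAddCommGroup E] [InnerProductSpace ℝ E] [FiniteDimensional ℝ E] [MeasurableSpace E]
  [BorelSpace E] in
/-- An a.e. property on `(0, T)` holds somewhere in every subinterval `(a, b)`,
`0 ≤ a < b ≤ T` (it has positive measure). [folklore] -/
theorem exists_mem_Ioo_of_ae_restrict_Ioo {T a b : ℝ} {P : ℝ → Prop} (ha : 0 ≤ a) (hab : a < b)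
    (hbT : b ≤ T) (h : ∀ᵐ t ∂(volume.restrict (Ioo 0 T)), P t) : ∃ t ∈ Ioo a b, P t := by
  by_contra hne
  push Not at hne
  have h' : ∀ᵐ t ∂(volume.restrict (Ioo a b)), P t :=
    ae_mono (Measure.restrict_mono (Ioo_subset_Ioo ha hbT) le_rfl) h
  have hfalse : ∀ᵐ t ∂(volume.restrict (Ioo a b)), False := by
    filter_upwards [h', ae_restrict_mem measurableSet_Ioo] with t ht ht'
    exact hne t ht' ht
  rw [ae_iff] at hfalse
  simp only [not_false_eq_true, setOf_true, Measure.restrict_apply_univ, Real.volume_Ioo,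
    ENNReal.ofReal_eq_zero, sub_nonpos] at hfalse
  linarith

/-- **Some good restarting time in every interval.** For a Leray–Hopf weak solution `u` of the
unforced system on `E × [0, T)` and all `0 ≤ a < b ≤ T` there is `s ∈ (a, b)` such that
`u(· + s)` is a Leray–Hopf weak solution on `[0, T - s)` from `u(s)`: the restart holds from
a.e. `s ∈ (0, T)` (`IsLerayHopfOn.ae_isLerayHopfOn_restart`, `LerayHopfRestart`; Robinson–
Rodrigo–Sadowski 2016, Ch. 8, p. 121, proof of Lemma 8.4: "Take any `t' ∈ (t₀ - δ, t₀)` such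
that … the energy inequality holds for `t'`"). The tree's `exists_isLerayHopfOn_restart` is the
case `a = 0`. [cite: RobinsonRodrigoSadowski2016, Ch. 8 p. 121 (proof of Lemma 8.4)] -/
theorem IsLerayHopfOn.exists_isLerayHopfOn_restart_Ioo (hLH : IsLerayHopfOn T ν 0 u₀ u)
    (hν : 0 ≤ ν) {a b : ℝ} (ha : 0 ≤ a) (hab : a < b) (hbT : b ≤ T) :
    ∃ s ∈ Ioo a b, IsLerayHopfOn (T - s) ν 0 (u s) (fun t => u (t + s)) :=
  exists_mem_Ioo_of_ae_restrict_Ioo ha hab hbT (hLH.ae_isLerayHopfOn_restart hν)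

end Restart

end Literature.Analysis.FluidPDE

/-! ## The named facts: Lemma 3.2 and Thm. 2.4 (`s = 1`) in the paper's `H¹` form -/

namespace Literature.Analysis.FluidPDE

/-- Local notation for physical space `ℝ³ = EuclideanSpace ℝ (Fin 3)`. -/
local notation "ℝ³" => EuclideanSpace ℝ (Fin 3)

/-- Local notation for the complexified target `ℂ³ = EuclideanSpace ℂ (Fin 3)`. -/
local notation "ℂ³" => EuclideanSpace ℂ (Fin 3)

/-- **Cheskidov–Shvydkoy's dyadic regularity criterion, as printed** (Arch. Ration. Mech. Anal.
195 (2010), Lemma 3.2, p. 5 of arXiv:0708.3067: "Let `u(t)` be a Leray–Hopf solution of (NSE) on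
`[0,T]`. There is a constant `c > 0` such that if
`limsup_{q → ∞} sup_{t ∈ (0,T)} λ_q⁻¹ ‖u_q(t)‖_∞ < cν` then `u(t)` is regular on `(0,T]`"),
with the paper's own meaning of "regular on `(0, T]`" (p. 4): `‖u(t)‖_{H¹}` is continuous on
`(0, T]` — here `Fluid.IsH1RegularOn (Ioc 0 T) u` (finite and continuous squared `H¹` norm
`‖u(t)‖² + ‖∇u(t)‖²`, weak gradient; see the module docstring, §Conventions). Hypotheses and
dyadic quantity exactly as in the house-form twin `NS.cheskidov_shvydkoy_dyadic`
(`CheskidovShvydkoy.lean`): `ν > 0`, `u` a Leray–Hopf weak solution of the unforced system on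
`ℝ³ × [0, T)` (`Fluid.IsLerayHopfOn`, at least as strong as CS Def. 2.3), `U t` the tempered
distribution of the slice `u t` (`t ∈ [0, T]`), and `λ_q⁻¹ ‖u_q(t)‖_∞ = 2 · 2^{-(q+1)}
‖Δ̇_{q+1} U(t)‖_∞` in the conventions of `LittlewoodPaley.lean`, the factor `2` being absorbed
in the existential absolute constant `c` (proof of Lemma 3.2, p. 5: `c = ν/C`, "`C > 0` an
absolute constant independent of `u`"). The house form follows from this one and ns.S07
(`cheskidov_shvydkoy_dyadic_of_regular`). [cite: CheskidovShvydkoy2010, Lemma 3.2] -/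
def cheskidov_shvydkoy_dyadic_regular : Prop :=
  ∃ c : ℝ, 0 < c ∧ ∀ (ν T : ℝ), 0 < ν → 0 < T → ∀ (u₀ : ℝ³ → ℝ³) (u : ℝ → ℝ³ → ℝ³)
      (U : ℝ → 𝓢'(ℝ³, ℂ³)), FluidPDE.IsLerayHopfOn T ν 0 u₀ u →
      (∀ t ∈ Icc 0 T, IsDistributionOf (u t) (U t)) →
      limsup (fun j : ℕ => ⨆ t ∈ Ioo 0 T, FunctionSpaces.lpBlockWeight (-1) ∞ (U t) (j : ℤ)) atTop <
        ENNReal.ofReal (c * ν) →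
      FluidPDE.IsH1RegularOn (Ioc 0 T) u

/-- **Leray's continuation theorem, the case `s = 1`** (Cheskidov–Shvydkoy 2010, Thm. 2.4
("Leray"), p. 4 of arXiv:0708.3067: "Let `u(t)` be a Leray–Hopf solution of (NSE) on `[0,T]`.
If for every interval of regularity `(α, β) ⊂ (0,T)`, `limsup_{t → β-} ‖u(t)‖_{H^s} < ∞` for
some `s > 1/2`, then `u(t)` is regular on `(0,T]`" — "a well-known fact concerning Leray–Hopf
solutions"; the mechanism is Leray's structure theorem, Robinson–Rodrigo–Sadowski 2016, §8.1,
Lemma 8.4 and Thm. 8.14: at a good time `t'` close to `β` with `‖u(t')‖_{H¹} ≤ M` the local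
strong solution lives for a time `≥ c‖∇u(t')‖⁻⁴` independent of `t'` (RRS p. 121 and
Thm. 6.8) and coincides with `u` by weak–strong uniqueness (RRS Thm. 8.19, proved in the tree as
`NS.serrin_weak_strong_uniqueness_holds`), so `u` is regular past `β`). Vendored in the instance
`s = 1` used in the proof of Thm. 3.1 (the printed hypothesis "for some `s > 1/2`" is implied by
its case `s = 1`), with "regular" and `‖·‖_{H¹}` as in `cheskidov_shvydkoy_dyadic_regular`
(`Fluid.IsH1RegularOn`, `Fluid.eH1NormSq`) and "interval of regularity `(α, β) ⊂ (0, T)`"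
rendered as *any* open interval `(α, β)`, `0 ≤ α < β ≤ T`, on which `u` is `H¹`-regular (a
hypothesis at least as strong as the printed one, which concerns the maximal such intervals;
see the module docstring). Statement: `ν > 0`, `u` a Leray–Hopf weak solution of the unforced
system on `ℝ³ × [0, T)`; if `limsup_{t → β⁻} ‖u(t)‖²_{H¹} < ∞` at the right end of every such
interval, then `u` is `H¹`-regular on `(0, T]`. [cite: CheskidovShvydkoy2010, Thm. 2.4 (case s = 1)] -/
def leray_continuation_H1 : Prop :=
  ∀ (ν T : ℝ), 0 < ν → 0 < T → ∀ (u₀ : ℝ³ → ℝ³) (u : ℝ → ℝ³ → ℝ³),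
    FluidPDE.IsLerayHopfOn T ν 0 u₀ u →
    (∀ α β : ℝ, 0 ≤ α → α < β → β ≤ T → FluidPDE.IsH1RegularOn (Ioo α β) u →
      limsup (fun t => FluidPDE.eH1NormSq (u t)) (𝓝[<] β) < ∞) →
    FluidPDE.IsH1RegularOn (Ioc 0 T) u

/-! ## From `H¹`-regularity to a classical representative (via ns.S07) -/

section Classical

variable {ν T : ℝ} {u₀ : ℝ³ → ℝ³} {u : ℝ → ℝ³ → ℝ³}

/-- **An `H¹`-regular Leray–Hopf solution restarted at a good time is in the Serrin class
`L^∞_t L⁶_x`.** If `u` is `H¹`-regular on `(0, T]` and `0 < s < T`, then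
`u(· + s) ∈ L^∞(0, T - s; L⁶(ℝ³))` (`Fluid.MemLqLp ∞ 6`): on the compact `[s, T]` the squared
`H¹` norm is bounded by some `M < ∞` (`IsH1RegularOn.exists_forall_le`), each slice then has a
weak gradient with `∫⁻ |G|² < M + 1` (`exists_hasWeakGradient_of_eH1NormSq_lt`), and
`‖u(t)‖_{L⁶} ≤ K (∫⁻ |G|²)^{1/2}` (`Fluid.eLpNorm_six_le_lintegral_frobeniusNormSq_weakGradient`,
the Sobolev inequality `H¹(ℝ³) ⊂ L⁶(ℝ³)`; Robinson–Rodrigo–Sadowski 2016, proof of Lemma 8.18: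
"`‖u‖_{L⁶} ≤ c‖∇u‖`"). [folklore] -/
theorem memLqLp_top_six_translate_of_isH1RegularOn (hLH : FluidPDE.IsLerayHopfOn T ν 0 u₀ u)
    (hreg : FluidPDE.IsH1RegularOn (Ioc 0 T) u) {s : ℝ} (hs : s ∈ Ioo 0 T) :
    FluidPDE.MemLqLp ∞ 6 (fun t => u (t + s)) (Ioo 0 (T - s)) := by
  -- uniform `H¹` bound on `[s, T]`
  obtain ⟨M, hM, hbound⟩ := hreg.exists_forall_le isCompact_Icc
    (fun t ht => ⟨hs.1.trans_le ht.1, ht.2⟩ : Icc s T ⊆ Ioc 0 T)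
  set K₆ : ℝ≥0 := SNormLESNormFDerivOfEqConst ℝ³ (volume : Measure ℝ³) 2 with hK₆
  set B : ℝ≥0∞ := (K₆ : ℝ≥0∞) * (M + 1) ^ (1 / 2 : ℝ) with hB
  have hBtop : B < ∞ := ENNReal.mul_lt_top ENNReal.coe_lt_top
    (ENNReal.rpow_lt_top_of_nonneg (by norm_num) (ENNReal.add_ne_top.2 ⟨hM.ne, ENNReal.one_ne_top⟩))
  -- slice-wise `L⁶` bound
  have hslice : ∀ t ∈ Ioo 0 (T - s), MemLp (u (t + s)) 6 volume ∧ eLpNorm (u (t + s)) 6 volume ≤ B := by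
    intro t ht
    have hts : t + s ∈ Icc s T := ⟨by linarith [ht.1], by linarith [ht.2]⟩
    have hu2 : MemLp (u (t + s)) 2 volume :=
      hLH.memLp (t + s) ⟨hs.1.le.trans hts.1, hts.2⟩
    have hlt : FluidPDE.eH1NormSq (u (t + s)) < M + 1 :=
      lt_of_le_of_lt (hbound _ hts) (ENNReal.lt_add_right hM.ne one_ne_zero)
    obtain ⟨G, hG, hGlt⟩ := FluidPDE.exists_hasWeakGradient_of_eH1NormSq_lt hlt
    have hG2 : ∫⁻ x, ENNReal.ofReal (FluidPDE.frobeniusNormSq (G x)) ≤ M + 1 :=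
      (le_add_self.trans hGlt.le)
    have h6 : eLpNorm (u (t + s)) 6 volume ≤ B := by
      refine (FluidPDE.eLpNorm_six_le_lintegral_frobeniusNormSq_weakGradient
        finrank_euclideanSpace_fin hG hu2.eLpNorm_lt_top).trans ?_
      rw [hB]
      gcongr
    exact ⟨⟨hu2.1, h6.trans_lt hBtop⟩, h6⟩
  refine ⟨(ae_restrict_iff' measurableSet_Ioo).2 (ae_of_all _ fun t ht => (hslice t ht).1), ?_⟩
  -- the `L^∞_t` bound
  rw [FluidPDE.eLqLpNorm, eLpNorm_exponent_top]
  refine eLpNormEssSup_lt_top_of_ae_bound (C := B.toReal) ?_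
  refine (ae_restrict_iff' measurableSet_Ioo).2 (ae_of_all _ fun t ht => ?_)
  rw [Real.norm_eq_abs, abs_of_nonneg ENNReal.toReal_nonneg]
  exact ENNReal.toReal_mono hBtop.ne (hslice t ht).2

/-- **A restarted `H¹`-regular Leray–Hopf solution has a classical representative on its final
segment** (ns.S07 applied in the Serrin class `L^∞_t L⁶_x`, `2/∞ + 3/6 ≤ 1`, `6 > 3`): if
`u(· + s)` is Leray–Hopf on `[0, T - s)` from `u(s)` (`0 < s < T`) and `u` is `H¹`-regular on
`(0, T]`, there is a classical solution `(V, P)` on the time set `Ioc s T` with `u(t) = V(t)`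
a.e. for every `t ∈ (s, T]` (translate the representative of `u(· + s)` on `Ioc 0 (T - s)`
back by `IsClassicalNSSolutionOn.comp_add_right`; Robinson–Rodrigo–Sadowski 2016, Thm. 8.17 and
the remark before it). [cite: RobinsonRodrigoSadowski2016, Thm. 8.17 (with the preceding remark)] -/
theorem exists_classical_Ioc_of_isH1RegularOn (hLPS : ladyzhenskaya_prodi_serrin)
    (hν : 0 < ν) (hLH : FluidPDE.IsLerayHopfOn T ν 0 u₀ u)
    (hreg : FluidPDE.IsH1RegularOn (Ioc 0 T) u) {s : ℝ} (hs : s ∈ Ioo 0 T)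
    (hLHs : FluidPDE.IsLerayHopfOn (T - s) ν 0 (u s) (fun t => u (t + s))) :
    ∃ (V : ℝ → ℝ³ → ℝ³) (P : ℝ → ℝ³ → ℝ),
      FluidPDE.IsClassicalNSSolutionOn (Ioc s T) ν 0 V P ∧ ∀ t ∈ Ioc s T, u t =ᵐ[volume] V t := by
  have hTs : 0 < T - s := sub_pos.2 hs.2
  have hS := memLqLp_top_six_translate_of_isH1RegularOn hLH hreg hs
  have hqr : 2 / (∞ : ℝ≥0∞) + 3 / 6 ≤ 1 := by
    rw [ENNReal.div_top, zero_add]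
    exact ENNReal.div_le_of_le_mul (by norm_num)
  obtain ⟨v, p, hcl, hae⟩ := hLPS hν hTs hLHs (q := ∞) (r := 6) (by norm_num) hqr hS
  -- translate back by `-s`
  have hcl' := hcl.comp_add_right (-s)
  have hsub : Ioc s T ⊆ (· + -s) ⁻¹' Ioc 0 (T - s) := fun t ht =>
    ⟨by simp only; linarith [ht.1], by simp only; linarith [ht.2]⟩
  have h0 : (fun t => (0 : ℝ → ℝ³ → ℝ³) (t + -s)) = 0 := rfl
  rw [h0] at hcl'
  refine ⟨fun t => v (t + -s), fun t => p (t + -s), hcl'.mono hsub (uniqueDiffOn_Ioc s T),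
    fun t ht => ?_⟩
  have h1 := hae (t + -s) ⟨by linarith [ht.1], by linarith [ht.2]⟩
  simp only [neg_add_cancel_right] at h1
  exact h1

/-- **`H¹`-regular Leray–Hopf solutions have a classical representative on `(0, T]`** (the
passage from Cheskidov–Shvydkoy's "regular on `(0, T]`" to the house rendering of ns.S07 /
`NS.cheskidov_shvydkoy`; Robinson–Rodrigo–Sadowski 2016, Thm. 8.17: "Then `u` is smooth on the
time interval `(0, T]`", obtained there, as here, by restarting at good times `t_n → 0` — "we
use here the uniqueness of strong solutions in the class of Leray–Hopf weak solutions" is not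
needed in the present rendering, which only asserts a representative). Given the accepted
Ladyzhenskaya–Prodi–Serrin fact `NS.ladyzhenskaya_prodi_serrin`: restart `u` at good times
`s_n ∈ (0, T/(n+2))` (`Fluid.IsLerayHopfOn.exists_isLerayHopfOn_restart`, `LerayHopfRestart`),
represent each restart classically on `(s_n, T]` (`exists_classical_Ioc_of_isH1RegularOn`),
observe that two representatives agree
on the common time set (a.e.-equal continuous slices are equal), and glue
(`Fluid.IsClassicalNSSolutionOn.exists_glue_Ioc`). [cite: RobinsonRodrigoSadowski2016, Thm. 8.17 (with the preceding remark)] -/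
theorem classical_of_isH1RegularOn (hLPS : ladyzhenskaya_prodi_serrin) (hν : 0 < ν) (hT : 0 < T)
    (hLH : FluidPDE.IsLerayHopfOn T ν 0 u₀ u) (hreg : FluidPDE.IsH1RegularOn (Ioc 0 T) u) :
    ∃ (v : ℝ → ℝ³ → ℝ³) (p : ℝ → ℝ³ → ℝ),
      FluidPDE.IsClassicalNSSolutionOn (Ioc 0 T) ν 0 v p ∧ ∀ t ∈ Ioc 0 T, u t =ᵐ[volume] v t := by
  -- good restarting times `s n ∈ (0, T/(n+2))` and classical representatives on `(s n, T]`
  have hδ : ∀ n : ℕ, 0 < T / (n + 2) ∧ T / (n + 2) ≤ T := fun n =>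
    ⟨by positivity, div_le_self hT.le (by linarith [n.cast_nonneg (α := ℝ)])⟩
  have hpiece : ∀ n : ℕ, ∃ s ∈ Ioo 0 (T / (n + 2)), ∃ (V : ℝ → ℝ³ → ℝ³) (P : ℝ → ℝ³ → ℝ),
      FluidPDE.IsClassicalNSSolutionOn (Ioc s T) ν 0 V P ∧ ∀ t ∈ Ioc s T, u t =ᵐ[volume] V t := by
    intro n
    obtain ⟨s, hs, hLHs⟩ := hLH.exists_isLerayHopfOn_restart hν.le (hδ n).1 (hδ n).2
    have hs' : s ∈ Ioo 0 T := ⟨hs.1, hs.2.trans_le (hδ n).2⟩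
    obtain ⟨V, P, hV, hrep⟩ := exists_classical_Ioc_of_isH1RegularOn hLPS hν hLH hreg hs' hLHs
    exact ⟨s, hs, V, P, hV, hrep⟩
  choose s hs V P hV hrep using hpiece
  have hs0 : ∀ n, 0 < s n := fun n => (hs n).1
  have hsmall : ∀ t, 0 < t → ∃ n, s n < t := by
    intro t ht
    obtain ⟨n, hn⟩ := exists_nat_gt (T / t)
    refine ⟨n, (hs n).2.trans ?_⟩
    rw [div_lt_iff₀ (by positivity)]
    rw [div_lt_iff₀ ht] at hn
    nlinarith
  -- two representatives agree on the common time set (continuous slices, a.e. equal)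
  have hagree : ∀ m n, ∀ t ∈ Ioc (max (s m) (s n)) T, V m t = V n t := by
    intro m n t ht
    have htm : t ∈ Ioc (s m) T := ⟨(le_max_left _ _).trans_lt ht.1, ht.2⟩
    have htn : t ∈ Ioc (s n) T := ⟨(le_max_right _ _).trans_lt ht.1, ht.2⟩
    have hae : V m t =ᵐ[volume] V n t := (hrep m t htm).symm.trans (hrep n t htn)
    exact (Continuous.ae_eq_iff_eq volume ((hV m).contDiff_velocity htm).continuous
      ((hV n).contDiff_velocity htn).continuous).1 hae
  obtain ⟨v, p, hvp, hvV⟩ := IsClassicalNSSolutionOn.exists_glue_Ioc hs0 hsmall hV hagree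
  refine ⟨v, p, hvp, fun t ht => ?_⟩
  obtain ⟨n, hn⟩ := hsmall t ht.1
  rw [hvV n t ⟨hn, ht.2⟩]
  exact hrep n t ⟨hn, ht.2⟩

end Classical

end Literature.Analysis.FluidPDE

end
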